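import Summits.CriticalPhenomena.Ising3DConformalLimit.Theorems.IsingEuclidUpgradeR4NonGaussianMomentRatioLowerBound
import Literature.Probability.LatticeModels.PointwiseScalingLimitEtaExists
import HarnessLib

/-!
# Crux `GaussianLimitNotScreened` (stmt-CriticalPhenomena-13886, route PerfectScreening r4), line
# `karamata-amplitude-blind-merging`: geometry and two-point inputs for the registered stub
# `stub_oneArmAsymptotics` (helper file 2/2 — THEOREM-ONLY, no definitions)

In the sub-namespace `OneArm`:

* §A the floor geometry of `[·/δ]` (`latticeApprox`): two-sided bounds
  `‖p − q‖_∞/δ − 2 ≤ ‖[p/δ] − [q/δ]‖_∞ ≤ ‖p − q‖_∞/δ + 2` (tree, `PointwiseScalingLimitTwoPointMono`)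
  and their consequences for the counting region `A(δ) = Λ_n + [z/δ]`, `z = (∑ᵢ‖xᵢ‖ + 5)e₀`,
  `(n+1)δ ≤ 1` of the landed `stub_momentRatioLowerBound` (crux 0636): it AVOIDS the marked points
  `x̃ᵢ = [xᵢ/δ]` (`z` is at sup distance `≥ 5` from every `xᵢ`) and sits in the ball of radius
  `(2∑ᵢ‖xᵢ‖ + 8)/δ` around each of them;
* §B the scaling dimension read off `ScaleCovariantOn` — `Δ ∈ [1/2, 3/4]` and `η = 2Δ − 1` exists
  (tree theorem `HasPointwiseScalingLimit.exists_rpow_scale_mem_Icc_threeQuarters`, the two exponents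
  identified at the reference pair) —, the lower bound `⟨σ₀σ_y⟩ ≥ ‖y‖^{−(2Δ+ε)}` for large `‖y‖` that
  the existence of `η` gives, the doubling relation `S₂(0,2e₀) = 2^{−2Δ}S₂(0,e₀)`, and the Simon–Lieb
  axis bound `1 ≤ c₀⁻¹8^J⟨σ₀σ_{2^Je₀}⟩` absorbing the diagonal of `M₂`;
* §C the dyadic-to-region transfer: given the Karamata dyadic shell bounds (hypotheses here; the
  registered neighbour stub `stub_dyadicShellSums` supplies them), the plain and the
  `‖y‖^{−s}`-weighted two-point sums over `Λ_{2n}`, `2^J ≤ n < 2^{J+1}`, are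
  `≤ K n³ ⟨σ₀σ_{2^Je₀}⟩ ≤ K n³ U/ρ(δ)²` (resp. with the extra factor `2^s C^s R^{−s}` when `R ≤ Cn`).

References: M. Aizenman, H. Duminil-Copin, Ann. of Math. 194 (2021) = arXiv:1912.07973, §4.2 Lemma 4.4;
H. Duminil-Copin, R. Panis, CMP 406 (2025), Thm 1.5; N. H. Bingham, C. M. Goldie, J. L. Teugels,
Regular Variation (1987), §1.5.
-/

noncomputable section

open Filter Topology Set Function MeasureTheory Finset
open Literature.Probability.LatticeModels Literature.Probability.Percolation
open Summit.CriticalPhenomena.Ising3DConformalLimit.Cruxes.IsingEuclidUpgradeR4NonGaussian.FreeCovarianceDeltaDichotomy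
  (lat ScaleCovariantOn)

namespace Summit.CriticalPhenomena.Ising3DConformalLimit.Cruxes.GaussianLimitNotScreened.KaramataAmplitudeBlindMerging

namespace OneArm

/-! ## §A. Floor geometry of `[·/δ]`: the counting region against the marked points -/

/-- `‖[p/δ] − [q/δ]‖_∞ ≤ ‖p − q‖_∞/δ + 2`. [folklore] -/
theorem norm_lat_sub_le {δ : ℝ} (hδ : 0 < δ) (p q : EuclideanSpace ℝ (Fin 3)) :
    (‖latticeApprox δ p - latticeApprox δ q‖ : ℝ) ≤ ‖WithLp.ofLp p - WithLp.ofLp q‖ / δ + 2 := by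
  rw [Site.norm_eq_supNorm]
  exact supNorm_latticeApprox_sub_le hδ p q

/-- `‖p − q‖_∞/δ − 2 ≤ ‖[p/δ] − [q/δ]‖_∞`. [folklore] -/
theorem le_norm_lat_sub {δ : ℝ} (hδ : 0 < δ) (p q : EuclideanSpace ℝ (Fin 3)) :
    ‖WithLp.ofLp p - WithLp.ofLp q‖ / δ - 2 ≤ (‖latticeApprox δ p - latticeApprox δ q‖ : ℝ) := by
  rw [Site.norm_eq_supNorm]
  exact le_supNorm_latticeApprox_sub (d := 3) (by norm_num) hδ p q

/-- For small `δ` two distinct macroscopic points have lattice points at distance `≥ ‖p − q‖_∞/(2δ)`.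
[folklore] -/
theorem half_div_le_norm_lat_sub {δ : ℝ} (hδ : 0 < δ) (p q : EuclideanSpace ℝ (Fin 3))
    (hδ4 : 4 * δ ≤ ‖WithLp.ofLp p - WithLp.ofLp q‖) :
    ‖WithLp.ofLp p - WithLp.ofLp q‖ / (2 * δ) ≤ (‖latticeApprox δ p - latticeApprox δ q‖ : ℝ) := by
  refine le_trans ?_ (le_norm_lat_sub hδ p q)
  have h1 : 2 ≤ ‖WithLp.ofLp p - WithLp.ofLp q‖ / (2 * δ) := by
    rw [le_div_iff₀ (by positivity)]; linarith
  have h2 : ‖WithLp.ofLp p - WithLp.ofLp q‖ / δ = 2 * (‖WithLp.ofLp p - WithLp.ofLp q‖ / (2 * δ)) := by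
    field_simp
  linarith

/-- For `4δ ≤ ‖p − q‖_∞` the lattice points `[p/δ]`, `[q/δ]` are distinct: `0 < ‖[p/δ] − [q/δ]‖_∞`. [folklore] -/
theorem norm_lat_sub_pos {δ : ℝ} (hδ : 0 < δ) (p q : EuclideanSpace ℝ (Fin 3))
    (hδ4 : 4 * δ ≤ ‖WithLp.ofLp p - WithLp.ofLp q‖) :
    0 < (‖latticeApprox δ p - latticeApprox δ q‖ : ℝ) :=
  lt_of_lt_of_le (div_pos (lt_of_lt_of_le (by positivity) hδ4) (by positivity))
    (half_div_le_norm_lat_sub hδ p q hδ4)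

/-- For `δ ≤ 1` the lattice points of two macroscopic points are at distance `≤ (‖p − q‖_∞ + 2)/δ`.
[folklore] -/
theorem norm_lat_sub_le_div {δ : ℝ} (hδ : 0 < δ) (hδ1 : δ ≤ 1) (p q : EuclideanSpace ℝ (Fin 3)) :
    (‖latticeApprox δ p - latticeApprox δ q‖ : ℝ) ≤ (‖WithLp.ofLp p - WithLp.ofLp q‖ + 2) / δ := by
  refine (norm_lat_sub_le hδ p q).trans ?_
  rw [add_div]
  have : (2:ℝ) ≤ 2 / δ := by rw [le_div_iff₀ hδ]; nlinarith
  linarith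

/-- The sup norm on `ℝ³` is bounded by the Euclidean norm. [folklore] -/
theorem norm_ofLp_le (w : EuclideanSpace ℝ (Fin 3)) : ‖WithLp.ofLp w‖ ≤ ‖w‖ :=
  (pi_norm_le_iff_of_nonneg (norm_nonneg _)).2 fun i => PiLp.norm_apply_le w i

/-- The far point `z = (∑ᵢ‖xᵢ‖ + 5)e₀` is at sup distance `∈ [5, 2∑ᵢ‖xᵢ‖ + 5]` from every `xᵢ`.
[folklore] -/
theorem norm_sub_far_point (x : Fin 4 → EuclideanSpace ℝ (Fin 3)) (i : Fin 4) :
    5 ≤ ‖WithLp.ofLp (x i) - WithLp.ofLp (((∑ j, ‖x j‖) + 5) •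
        EuclideanSpace.single (0 : Fin 3) (1:ℝ))‖ ∧
      ‖WithLp.ofLp (x i) - WithLp.ofLp (((∑ j, ‖x j‖) + 5) •
        EuclideanSpace.single (0 : Fin 3) (1:ℝ))‖ ≤ 2 * (∑ j, ‖x j‖) + 5 := by
  set Sx : ℝ := ∑ j, ‖x j‖ with hSx
  have hSx0 : 0 ≤ Sx := Finset.sum_nonneg fun j _ => norm_nonneg (x j)
  have hxi : ‖x i‖ ≤ Sx := Finset.single_le_sum (fun j _ => norm_nonneg (x j)) (Finset.mem_univ i)
  set z : EuclideanSpace ℝ (Fin 3) := (Sx + 5) • EuclideanSpace.single (0 : Fin 3) (1:ℝ) with hz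
  have hz0 : z 0 = Sx + 5 := by simp [hz]
  have hznorm : ‖z‖ = Sx + 5 := by
    rw [hz, norm_smul, Real.norm_eq_abs, PiLp.norm_single, norm_one, mul_one,
      abs_of_nonneg (by linarith)]
  constructor
  · have h0 : |x i 0| ≤ Sx := by
      have h := PiLp.norm_apply_le (x i) 0
      rw [Real.norm_eq_abs] at h
      exact h.trans hxi
    have h1 := norm_le_pi_norm (WithLp.ofLp (x i) - WithLp.ofLp z) 0
    rw [Real.norm_eq_abs, Pi.sub_apply] at h1
    have h2 : (5:ℝ) ≤ |(WithLp.ofLp (x i)) 0 - (WithLp.ofLp z) 0| := by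
      rw [hz0, abs_sub_comm, le_abs]
      left
      rw [abs_le] at h0
      linarith [h0.2]
    exact h2.trans h1
  · calc ‖WithLp.ofLp (x i) - WithLp.ofLp z‖ ≤ ‖WithLp.ofLp (x i)‖ + ‖WithLp.ofLp z‖ := norm_sub_le _ _
      _ ≤ ‖x i‖ + ‖z‖ := add_le_add (norm_ofLp_le _) (norm_ofLp_le _)
      _ ≤ Sx + (Sx + 5) := add_le_add hxi hznorm.le
      _ = 2 * Sx + 5 := by ring

/-- A site of `Λ_n` has norm `≤ n`. [folklore] -/
theorem norm_le_of_mem_box {n : ℕ} {u : Site 3} (hu : u ∈ box 3 n) : (‖u‖ : ℝ) ≤ n := by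
  rw [Site.norm_eq_supNorm]
  exact_mod_cast mem_box_iff_supNorm_le.1 hu

/-- **The counting region avoids the marked points**: for `u ∈ Λ_n`, `(n+1)δ ≤ 1`, `δ < 1`, the site
`u + [z/δ]` differs from every `[xᵢ/δ]` (`z` is at sup distance `≥ 5` from `xᵢ`). [folklore] -/
theorem region_point_ne_lat (x : Fin 4 → EuclideanSpace ℝ (Fin 3)) {δ : ℝ} (hδ : 0 < δ) (hδ1 : δ < 1)
    {n : ℕ} (hn : ((n:ℝ) + 1) * δ ≤ 1) {u : Site 3} (hu : u ∈ box 3 n) (i : Fin 4) :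
    u + latticeApprox δ (((∑ j, ‖x j‖) + 5) • EuclideanSpace.single (0 : Fin 3) (1:ℝ)) ≠ lat δ x i := by
  set z : EuclideanSpace ℝ (Fin 3) := ((∑ j, ‖x j‖) + 5) • EuclideanSpace.single (0 : Fin 3) (1:ℝ)
    with hz
  intro h
  have hu' : latticeApprox δ (x i) - latticeApprox δ z = u := by
    rw [show latticeApprox δ (x i) = u + latticeApprox δ z from h.symm, add_sub_cancel_right]
  have h1 : (‖latticeApprox δ (x i) - latticeApprox δ z‖ : ℝ) ≤ n := by
    rw [hu']; exact norm_le_of_mem_box hu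
  have h2 := le_norm_lat_sub hδ (x i) z
  have h5 := (norm_sub_far_point x i).1
  have hn' : (n:ℝ) ≤ 1 / δ - 1 := by
    rw [le_sub_iff_add_le, le_div_iff₀ hδ]; exact hn
  have h3 : 5 / δ - 2 ≤ ‖WithLp.ofLp (x i) - WithLp.ofLp z‖ / δ - 2 := by
    gcongr
  have h4 : 1 / δ - 1 < 5 / δ - 2 := by
    rw [div_sub' (hc := hδ.ne'), div_sub' (hc := hδ.ne'), div_lt_div_iff_of_pos_right hδ]; linarith
  linarith

/-- **The counting region sits in a ball of radius `≍ 1/δ` around every marked point**: for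
`u ∈ Λ_n`, `(n+1)δ ≤ 1`, `δ ≤ 1`: `‖u + [z/δ] − [xᵢ/δ]‖ ≤ (2∑ⱼ‖xⱼ‖ + 8)/δ`. [folklore] -/
theorem norm_region_point_sub_lat_le (x : Fin 4 → EuclideanSpace ℝ (Fin 3)) {δ : ℝ} (hδ : 0 < δ)
    (hδ1 : δ ≤ 1) {n : ℕ} (hn : ((n:ℝ) + 1) * δ ≤ 1) {u : Site 3} (hu : u ∈ box 3 n) (i : Fin 4) :
    (‖u + latticeApprox δ (((∑ j, ‖x j‖) + 5) • EuclideanSpace.single (0 : Fin 3) (1:ℝ)) -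
        lat δ x i‖ : ℝ) ≤ (2 * (∑ j, ‖x j‖) + 8) / δ := by
  set z : EuclideanSpace ℝ (Fin 3) := ((∑ j, ‖x j‖) + 5) • EuclideanSpace.single (0 : Fin 3) (1:ℝ)
    with hz
  have hn' : (n:ℝ) ≤ 1 / δ - 1 := by
    rw [le_sub_iff_add_le, le_div_iff₀ hδ]; exact hn
  have h1 : (‖u + latticeApprox δ z - lat δ x i‖ : ℝ) ≤ ‖u‖ + ‖latticeApprox δ z - latticeApprox δ (x i)‖ := by
    rw [add_sub_assoc]; exact norm_add_le _ _
  have h2 := norm_lat_sub_le_div hδ hδ1 z (x i)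
  have h3 : ‖WithLp.ofLp z - WithLp.ofLp (x i)‖ ≤ 2 * (∑ j, ‖x j‖) + 5 := by
    rw [norm_sub_rev]; exact (norm_sub_far_point x i).2
  have h4 : (‖latticeApprox δ z - latticeApprox δ (x i)‖ : ℝ) ≤ (2 * (∑ j, ‖x j‖) + 7) / δ := by
    refine h2.trans (div_le_div_of_nonneg_right ?_ hδ.le)
    linarith
  have h5 : (‖u‖ : ℝ) ≤ 1 / δ := (norm_le_of_mem_box hu).trans (by linarith)
  calc (‖u + latticeApprox δ z - lat δ x i‖ : ℝ) ≤ 1 / δ + (2 * (∑ j, ‖x j‖) + 7) / δ := by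
        linarith
    _ = (2 * (∑ j, ‖x j‖) + 8) / δ := by ring

/-! ## §B. The scaling dimension, `η`, and the two-point lower bound that `η` gives -/

/-- Scale covariance at `(0,e₀) ↦ (0,2e₀)` on non-coincident configurations:
`S₂(0,2e₀) = 2^{-2Δ} S₂(0,e₀)`. [folklore] -/
theorem S_two_unitVec_eq_of_covOn {Δ : ℝ} {S : CorrFamily 3} (hcov : ScaleCovariantOn Δ S) :
    S 2 ![0, EuclideanSpace.single (0 : Fin 3) ((2 : ℕ) : ℝ)] =
      (2 : ℝ) ^ (-(2 : ℝ) * Δ) * S 2 ![0, EuclideanSpace.single (0 : Fin 3) ((1 : ℕ) : ℝ)] := by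
  -- adapted from `FreeCovarianceDeltaDichotomy.S_two_unitVec_eq_of_covOn` (…MomentRatioLowerBound)
  have h := hcov 2 2 (by norm_num) ![0, EuclideanSpace.single (0 : Fin 3) ((1 : ℕ) : ℝ)]
    (zero_unitVec_mem_nonCoincident (by norm_num))
  have hcfg : (fun i => (2 : ℝ) • (![0, EuclideanSpace.single (0 : Fin 3) ((1 : ℕ) : ℝ)] :
      Fin 2 → EuclideanSpace ℝ (Fin 3)) i) = ![0, EuclideanSpace.single (0 : Fin 3) ((2 : ℕ) : ℝ)] := by
    funext i
    fin_cases i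
    · simp
    · simp only [Nat.cast_ofNat, Fin.mk_one, Matrix.cons_val_one, Matrix.cons_val_fin_one,
        Nat.cast_one]
      ext j
      simp
  rw [hcfg] at h
  rw [h]
  norm_num

/-- **The window and `η`, from `ScaleCovariantOn`**: the scaling dimension of a non-degenerate
pointwise limit of `criticalCorr 3` that is scale covariant on non-coincident configurations with
exponent `Δ` lies in `[1/2, 3/4]`, and `η = 2Δ − 1` exists (tree theorem
`HasPointwiseScalingLimit.exists_rpow_scale_mem_Icc_threeQuarters`; the two exponents are identified
at the reference pair `(0, e₀)`). [cite: DuminilCopinPanis2025LowerBounds, Theorem 1.5] -/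
theorem window_and_eta_of_covOn {ρ : ℝ → ℝ} {Δ : ℝ} {S : CorrFamily 3}
    (hρ : ∀ δ ∈ Set.Ioc (0:ℝ) 1, 0 < ρ δ)
    (hlim : HasPointwiseScalingLimit (criticalCorr 3) ρ S) (hnd : IsNondegenerateTwoPoint S)
    (hcov : ScaleCovariantOn Δ S) :
    Δ ∈ Set.Icc (1/2 : ℝ) (3/4) ∧ HasIsingExponentEta 3 (2 * Δ - 1) := by
  -- adapted from the skeleton's `dimension_window_and_eta` (line karamata-amplitude-blind-merging)
  obtain ⟨Δ', hΔ', hcov', -, hη⟩ := hlim.exists_rpow_scale_mem_Icc_threeQuarters hρ hnd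
  have hx₀ := refPair_mem_nonCoincident (d := 3) (by norm_num)
  set x₀ : Fin 2 → EuclideanSpace ℝ (Fin 3) :=
    ![0, EuclideanSpace.single (⟨0, by norm_num⟩ : Fin 3) (1:ℝ)]
  have ha : 0 < S 2 x₀ := hnd _ hx₀
  have heq : Δ = Δ' := by
    have e₁ := hcov 2 2 two_pos x₀ hx₀
    have e₂ := hcov' 2 2 two_pos x₀ hx₀
    rw [e₁] at e₂
    have h := mul_right_cancel₀ ha.ne' e₂
    have h' := congrArg Real.log h
    rw [Real.log_rpow two_pos, Real.log_rpow two_pos] at h'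
    have hl : Real.log 2 ≠ 0 := (Real.log_pos one_lt_two).ne'
    have := mul_right_cancel₀ hl h'
    push_cast at this
    linarith
  subst heq
  exact ⟨hΔ', hη⟩

/-- **What the existence of `η` gives below**: if `log⟨σ₀σ_y⟩/log‖y‖ → −(1 + η)` then for every
`ε > 0` there is `B` with `‖y‖^{−(1+η+ε)} ≤ ⟨σ₀σ_y⟩_{β_c}` whenever `‖y‖ ≥ B`. [folklore] -/
theorem rpow_le_criticalTwoPoint_of_eta {η : ℝ} (hη : HasIsingExponentEta 3 η) {ε : ℝ} (hε : 0 < ε) :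
    ∃ B : ℝ, ∀ y : Site 3, B ≤ ‖y‖ → (‖y‖ : ℝ) ^ (-(1 + η + ε)) ≤ criticalTwoPoint 3 y := by
  unfold HasIsingExponentEta HasSpatialDecayExponent at hη
  have htarget : (-(((3:ℕ):ℝ) - 2 + η)) = -(1 + η) := by push_cast; ring
  rw [htarget] at hη
  have hev := (Metric.tendsto_nhds.1 hη) ε hε
  rw [Filter.eventually_cofinite] at hev
  obtain ⟨B₀, hB₀⟩ := (hev.image fun y : Site 3 => (‖y‖ : ℝ)).bddAbove
  refine ⟨max 2 (B₀ + 1), fun y hy => ?_⟩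
  have hy2 : (2:ℝ) ≤ ‖y‖ := (le_max_left _ _).trans hy
  have hyB : B₀ + 1 ≤ ‖y‖ := (le_max_right _ _).trans hy
  have hgood : dist (Real.log (criticalTwoPoint 3 y) / Real.log ‖y‖) (-(1 + η)) < ε := by
    by_contra h
    have hmem : (‖y‖ : ℝ) ∈ (fun y : Site 3 => (‖y‖ : ℝ)) '' {x | ¬dist (Real.log (criticalTwoPoint 3 x) /
        Real.log ‖x‖) (-(1 + η)) < ε} := ⟨y, h, rfl⟩
    have := hB₀ hmem
    linarith
  have hlog : 0 < Real.log ‖y‖ := Real.log_pos (by linarith)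
  have hy0 : y ≠ 0 := by
    intro h; rw [h, norm_zero] at hy2; linarith
  have hGpos : 0 < criticalTwoPoint 3 y := by
    obtain ⟨c, C, hc, hbd⟩ := criticalTwoPoint_bounds_holds (d := 3) le_rfl
    exact lt_of_lt_of_le (mul_pos hc (Real.rpow_pos_of_pos (by linarith) _)) (hbd y hy0).1
  rw [Real.dist_eq, abs_lt] at hgood
  have h1 : -(1 + η + ε) * Real.log ‖y‖ < Real.log (criticalTwoPoint 3 y) := by
    have := hgood.1
    have h2 : -(1 + η) - ε < Real.log (criticalTwoPoint 3 y) / Real.log ‖y‖ := by linarith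
    rw [lt_div_iff₀ hlog] at h2
    linarith
  rw [← Real.log_rpow (by linarith)] at h1
  exact (Real.log_lt_log_iff (Real.rpow_pos_of_pos (by linarith) _) hGpos).1 h1 |>.le

/-- **Simon–Lieb on the axis**: `1 ≤ c⁻¹ 8^J ⟨σ₀σ_{2^J e₀}⟩` where `c‖y‖^{−2} ≤ ⟨σ₀σ_y⟩` is the tree's
lower critical two-point bound (`criticalTwoPoint_bounds_holds`) — the diagonal `⟨σ_vσ_v⟩ = 1` of
`M₂` is dominated by the top dyadic shell. [cite: DuminilCopin2019, Thm. 4.8, §4.4] -/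
theorem one_le_axis_shell : ∃ c₀ : ℝ, 0 < c₀ ∧ ∀ J : ℕ,
    1 ≤ c₀⁻¹ * (8:ℝ) ^ J * criticalTwoPoint 3 (Pi.single (0 : Fin 3) ((2:ℤ) ^ J)) := by
  obtain ⟨c, C, hc, hbd⟩ := criticalTwoPoint_bounds_holds (d := 3) le_rfl
  refine ⟨c, hc, fun J => ?_⟩
  have hne : (Pi.single (0 : Fin 3) ((2:ℤ) ^ J) : Site 3) ≠ 0 := by
    intro h
    have := congrFun h 0
    simp at this
  have hnorm : ‖(Pi.single (0 : Fin 3) ((2:ℤ) ^ J) : Site 3)‖ = (2:ℝ) ^ J := by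
    rw [Pi.norm_single, Int.norm_eq_abs]; push_cast; exact abs_of_pos (by positivity)
  have h := (hbd _ hne).1
  rw [hnorm] at h
  have e : ((2:ℝ) ^ J) ^ (-(((3:ℕ):ℝ) - 1)) = ((4:ℝ) ^ J)⁻¹ := by
    rw [show (-(((3:ℕ):ℝ) - 1)) = -((2:ℕ):ℝ) by push_cast; ring, Real.rpow_neg (by positivity),
      Real.rpow_natCast, ← pow_mul, pow_mul']
    norm_num
  rw [e] at h
  have h8 : (8:ℝ) ^ J = 2 ^ J * 4 ^ J := by rw [← mul_pow]; norm_num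
  have h4 : (0:ℝ) < 4 ^ J := by positivity
  calc (1:ℝ) ≤ 2 ^ J := one_le_pow₀ (by norm_num)
    _ = c⁻¹ * (8:ℝ) ^ J * (c * ((4:ℝ) ^ J)⁻¹) := by rw [h8]; field_simp
    _ ≤ c⁻¹ * (8:ℝ) ^ J * criticalTwoPoint 3 (Pi.single (0 : Fin 3) ((2:ℤ) ^ J)) :=
        mul_le_mul_of_nonneg_left h (by positivity)

/-! ## §C. The dyadic-to-region transfer -/

/-- `2^{-sJ} ≤ 2^s C^s R^{-s}` when `R ≤ C n` and `n < 2^{J+1}`. [folklore] -/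
theorem two_rpow_neg_le {s : ℝ} (hs : 0 < s) {n J : ℕ} (hnJ : n < 2 ^ (J + 1))
    {R C : ℝ} (hR : 0 < R) (hC : 0 < C) (hRn : R ≤ C * n) :
    (2:ℝ) ^ (-(s * J)) ≤ (2:ℝ) ^ s * C ^ s * R ^ (-s) := by
  have h2J : (0:ℝ) < 2 ^ J := by positivity
  have hle : R / (2 * C) ≤ (2:ℝ) ^ J := by
    rw [div_le_iff₀ (by positivity)]
    have : (n:ℝ) < 2 ^ (J + 1) := by exact_mod_cast hnJ
    rw [pow_succ] at this
    nlinarith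
  have e1 : (2:ℝ) ^ (-(s * J)) = ((2:ℝ) ^ J) ^ (-s) := by
    rw [show (-(s * J) : ℝ) = (J:ℝ) * (-s) by ring, Real.rpow_mul (by norm_num), Real.rpow_natCast]
  rw [e1]
  calc ((2:ℝ) ^ J) ^ (-s) ≤ (R / (2 * C)) ^ (-s) :=
        Real.rpow_le_rpow_of_nonpos (by positivity) hle (by linarith)
    _ = (2:ℝ) ^ s * C ^ s * R ^ (-s) := by
        rw [Real.div_rpow hR.le (by positivity), Real.rpow_neg (by positivity : (0:ℝ) ≤ 2 * C),
          Real.mul_rpow (by norm_num) hC.le]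
        field_simp

/-- **Mass sum over `Λ_{2n}` through the top dyadic shell**: `∑_{Λ_{2n}} ⟨σ₀σ_y⟩ ≤ (K₀ + c₀⁻¹) n³ U/ρ²`
(`2^J ≤ n < 2^{J+1}`; the origin is absorbed by `one_le_axis_shell`, the axis value by the window).
[cite: BinghamGoldieTeugels1987, §1.5 (Karamata's theorem for sums)] -/
theorem sum_box_two_mul_le {n J : ℕ} (hJn : 2 ^ J ≤ n) (hnJ : n < 2 ^ (J + 1)) {K₀ c₀ : ℝ}
    (hsum₀ : ∑ u ∈ (box 3 (2 ^ (J + 2))).erase 0, criticalTwoPoint 3 u ≤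
      K₀ * (8 : ℝ) ^ J * criticalTwoPoint 3 (Pi.single (0 : Fin 3) ((2 : ℤ) ^ J)))
    (hshell : 1 ≤ c₀⁻¹ * (8:ℝ) ^ J * criticalTwoPoint 3 (Pi.single (0 : Fin 3) ((2:ℤ) ^ J)))
    (hKc : 0 ≤ K₀ + c₀⁻¹) {U r : ℝ} (hr : 0 < r)
    (htop : r * criticalTwoPoint 3 (Pi.single (0 : Fin 3) ((2:ℤ) ^ J)) ≤ U) :
    ∑ y ∈ box 3 (2 * n), criticalTwoPoint 3 y ≤ (K₀ + c₀⁻¹) * (n:ℝ) ^ 3 * (U / r) := by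
  classical
  set g := criticalTwoPoint 3 (Pi.single (0 : Fin 3) ((2:ℤ) ^ J)) with hg
  have hsub : box 3 (2 * n) ⊆ box 3 (2 ^ (J + 2)) := box_mono 3 (by rw [pow_succ] at hnJ ⊢; omega)
  have h8 : (8:ℝ) ^ J ≤ (n:ℝ) ^ 3 := by
    have hh : (2 ^ J) ^ 3 ≤ n ^ 3 := Nat.pow_le_pow_left hJn 3
    have e8 : (8:ℝ) ^ J = (((2 ^ J) ^ 3 : ℕ) : ℝ) := by
      push_cast
      rw [← pow_mul, mul_comm, pow_mul]
      norm_num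
    rw [e8]
    exact_mod_cast hh
  have hgU : g ≤ U / r := by rw [le_div_iff₀ hr, mul_comm]; exact htop
  have hg0 : 0 ≤ g := criticalTwoPoint_nonneg' _
  calc ∑ y ∈ box 3 (2 * n), criticalTwoPoint 3 y
      ≤ ∑ y ∈ box 3 (2 ^ (J + 2)), criticalTwoPoint 3 y :=
        Finset.sum_le_sum_of_subset_of_nonneg hsub fun y _ _ => criticalTwoPoint_nonneg' y
    _ = criticalTwoPoint 3 0 + ∑ y ∈ (box 3 (2 ^ (J + 2))).erase 0, criticalTwoPoint 3 y :=
        (Finset.add_sum_erase _ _ (zero_mem_box 3 _)).symm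
    _ ≤ c₀⁻¹ * (8:ℝ) ^ J * g + K₀ * (8:ℝ) ^ J * g := by
        rw [criticalTwoPoint_zero']; exact add_le_add hshell hsum₀
    _ = (K₀ + c₀⁻¹) * ((8:ℝ) ^ J * g) := by ring
    _ ≤ (K₀ + c₀⁻¹) * ((n:ℝ) ^ 3 * (U / r)) :=
        mul_le_mul_of_nonneg_left (mul_le_mul h8 hgU hg0 (by positivity)) hKc
    _ = (K₀ + c₀⁻¹) * (n:ℝ) ^ 3 * (U / r) := by ring

/-- **Weighted sum over `Λ_{2n} ∖ {0}` through the top dyadic shell**: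
`∑_{0 < ‖y‖ ≤ 2n} ‖y‖^{-s}⟨σ₀σ_y⟩ ≤ K₁ n³ (2^s C^s R^{-s}) U/ρ²` when `R ≤ C n`.
[cite: BinghamGoldieTeugels1987, §1.5 (Karamata's theorem for sums)] -/
theorem wsum_box_two_mul_le {s : ℝ} (hs : 0 < s) {n J : ℕ} (hJn : 2 ^ J ≤ n) (hnJ : n < 2 ^ (J + 1))
    {K₁ : ℝ} (hK₁ : 0 ≤ K₁)
    (hsum₁ : ∑ u ∈ (box 3 (2 ^ (J + 2))).erase 0, (‖u‖ : ℝ) ^ (-s) * criticalTwoPoint 3 u ≤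
      K₁ * (8 : ℝ) ^ J * (2 : ℝ) ^ (-(s * J)) * criticalTwoPoint 3 (Pi.single (0 : Fin 3) ((2 : ℤ) ^ J)))
    {U r : ℝ} (hr : 0 < r) (htop : r * criticalTwoPoint 3 (Pi.single (0 : Fin 3) ((2:ℤ) ^ J)) ≤ U)
    {R C : ℝ} (hR : 0 < R) (hC : 0 < C) (hRn : R ≤ C * n) :
    ∑ y ∈ (box 3 (2 * n)).erase 0, (‖y‖ : ℝ) ^ (-s) * criticalTwoPoint 3 y ≤
      K₁ * (n:ℝ) ^ 3 * ((2:ℝ) ^ s * C ^ s * R ^ (-s)) * (U / r) := by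
  classical
  set g := criticalTwoPoint 3 (Pi.single (0 : Fin 3) ((2:ℤ) ^ J)) with hg
  have hsub : (box 3 (2 * n)).erase 0 ⊆ (box 3 (2 ^ (J + 2))).erase 0 :=
    Finset.erase_subset_erase _ (box_mono 3 (by rw [pow_succ] at hnJ ⊢; omega))
  have h8 : (8:ℝ) ^ J ≤ (n:ℝ) ^ 3 := by
    have hh : (2 ^ J) ^ 3 ≤ n ^ 3 := Nat.pow_le_pow_left hJn 3
    have e8 : (8:ℝ) ^ J = (((2 ^ J) ^ 3 : ℕ) : ℝ) := by
      push_cast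
      rw [← pow_mul, mul_comm, pow_mul]
      norm_num
    rw [e8]
    exact_mod_cast hh
  have hgU : g ≤ U / r := by rw [le_div_iff₀ hr, mul_comm]; exact htop
  have hg0 : 0 ≤ g := criticalTwoPoint_nonneg' _
  have h2 := two_rpow_neg_le hs hnJ hR hC hRn
  calc ∑ y ∈ (box 3 (2 * n)).erase 0, (‖y‖ : ℝ) ^ (-s) * criticalTwoPoint 3 y
      ≤ ∑ y ∈ (box 3 (2 ^ (J + 2))).erase 0, (‖y‖ : ℝ) ^ (-s) * criticalTwoPoint 3 y :=
        Finset.sum_le_sum_of_subset_of_nonneg hsub fun y _ _ =>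
          mul_nonneg (Real.rpow_nonneg (norm_nonneg _) _) (criticalTwoPoint_nonneg' y)
    _ ≤ K₁ * (8 : ℝ) ^ J * (2 : ℝ) ^ (-(s * J)) * g := hsum₁
    _ = K₁ * ((8 : ℝ) ^ J * (2 : ℝ) ^ (-(s * J)) * g) := by ring
    _ ≤ K₁ * ((n:ℝ) ^ 3 * ((2:ℝ) ^ s * C ^ s * R ^ (-s)) * (U / r)) := by
        refine mul_le_mul_of_nonneg_left ?_ hK₁
        exact mul_le_mul (mul_le_mul h8 h2 (by positivity) (by positivity)) hgU hg0 (by positivity)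
    _ = K₁ * (n:ℝ) ^ 3 * ((2:ℝ) ^ s * C ^ s * R ^ (-s)) * (U / r) := by ring

end OneArm

/-! ## Bookkeeping (the registered sub-goal through which this helper file lands `--supports`) -/

/-- **Registered bookkeeping stub `stub_oneArmAsymptoticsGeometry`** (sub-goal of
`stub_oneArmAsymptotics`, helper file 2/2): the scaling dimension of a non-degenerate pointwise limit
of `criticalCorr 3`, scale covariant on non-coincident configurations with exponent `Δ`, lies in
`[1/2, 3/4]`, and `η = 2Δ − 1` exists. [cite: DuminilCopinPanis2025LowerBounds, Theorem 1.5] -/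
theorem stub_oneArmAsymptoticsGeometry :
    ∀ (ρ : ℝ → ℝ) (S : CorrFamily 3) (Δ : ℝ), (∀ δ ∈ Set.Ioc (0:ℝ) 1, 0 < ρ δ) →
      HasPointwiseScalingLimit (criticalCorr 3) ρ S → IsNondegenerateTwoPoint S → ScaleCovariantOn Δ S →
      Δ ∈ Set.Icc (1/2 : ℝ) (3/4) ∧ HasIsingExponentEta 3 (2 * Δ - 1) :=
  fun _ _ _ hρ hlim hnd hcov => OneArm.window_and_eta_of_covOn hρ hlim hnd hcov

end Summit.CriticalPhenomena.Ising3DConformalLimit.Cruxes.GaussianLimitNotScreened.KaramataAmplitudeBlindMerging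

end
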